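import Literature.AlgebraicGeometry.Resolution.StrictTransformPersistence
import HarnessLib

/-!
# The strict transform along a blowing up is local on the source

Topic: `Literature/AlgebraicGeometry/Resolution`. Second step of the reduction of Raynaud–Gruson
flattening (Stacks, Tag 081R; named fact `Stacks081R`, `StrictTransformFlattening.lean`) to an
affine source (printed proof: "Since `X` is quasi-compact we can find a finite affine open
covering `X = ⋃ Xᵢ` …", tacitly using that the strict transform of `Xᵢ` is the open piece of the
strict transform of `X` lying over `Xᵢ`, and that flatness and finite presentation are local on
the source). For `f : X → S`, a morphism `b : S' → S` with `b⁻¹𝓘 𝒪_{S'}` an effective Cartier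
divisor (a blowing up in `𝓘`), and an open `X₀ ⊆ X`, the strict transform (Stacks 080D (2),
`blowupStrictTransform`) of `X₀ → S` is the restriction of the strict transform of `X` to the
open `X₀ ×_S S' ⊆ X ×_S S'`; consequently every property of morphisms which is Zariski-local on
the source (e.g. `Flat`, `LocallyOfFinitePresentation`) holds for the strict transform of `X`
as soon as it holds for the strict transforms of the members of an open cover of `X`.

* `quasiCompact_ι_preimage_centreCompl` — `(X ×_S S')|_{S' ∖ E} ↪ X ×_S S'` is quasi-compact
  (base change of the retrocompact `S' ∖ E ↪ S'`, `IsEffectiveCartier.quasiCompact_ι_centreCompl`);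
* `ker_ι_preimage_eq_comap` — scheme-theoretic images of quasi-compact open immersions commute
  with restriction to opens (Mathlib's `ker_ideal_of_isPullback_of_isOpenImmersion`);
* `of_forall_comap_subschemeι` — a Zariski-local-on-the-source property of `V(K) → S'` can be
  checked on the closed subschemes `V(K|_{T₀}) ⊆ T₀` for open immersions `T₀ → T` covering
  `Supp K`;
* `strictTransformOpenι X₀` — the open immersion `X₀ ×_S S' ↪ X ×_S S'`, with
  `strictTransformOpenι_snd`, `range_strictTransformOpenι`;
* `ker_blowupStrictTransformι_restrict` — **locality of the strict transform**: the ideal of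
  the strict transform of `X₀ → S` is the restriction of the ideal of the strict transform of
  `X → S`;
* `blowupStrictTransformMap_of_iSup_eq_top` — **`P` local on the source holds for the strict
  transform of `X` if it holds for the strict transforms of the `Xₖ`, `X = ⋃ Xₖ`.**

## References

* The Stacks Project, Tag 081R (proof, first paragraph), Tag 080D, Tag 01R8 (scheme-theoretic
  image and flat base change / restriction to opens). [StacksProject]
* M. Raynaud, L. Gruson, *Critères de platitude et de projectivité*, Invent. Math. 13 (1971),
  Première partie, 5.1–5.2. [RaynaudGruson1971]
-/

noncomputable section

open CategoryTheory CategoryTheory.Limits AlgebraicGeometry TopologicalSpace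

namespace Literature.AlgebraicGeometry.Resolution

universe u

/-! ## Generalities: quasi-compact open pieces and scheme-theoretic images -/

section General

/-- The open `h⁻¹(S' ∖ E) ↪ T` is quasi-compact for `E` an effective Cartier divisor of `S'`
(base change of the retrocompact `S' ∖ E ↪ S'`). [folklore] -/
theorem quasiCompact_ι_preimage_centreCompl {T S' : Scheme.{u}} (h : T ⟶ S')
    {K : S'.IdealSheafData} (hK : IsEffectiveCartier K) :
    QuasiCompact (h ⁻¹ᵁ centreCompl K).ι :=
  MorphismProperty.of_isPullback (isPullback_morphismRestrict h (centreCompl K))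
    hK.quasiCompact_ι_centreCompl

/-- **Scheme-theoretic images of quasi-compact open immersions commute with restriction to
opens**: for an open immersion `j : T₀ → T` and a quasi-compact open immersion `O ↪ T`, the
ideal of the closure of `j⁻¹O` in `T₀` is the restriction of the ideal of the closure of `O` in
`T`. [cite: StacksProject, Tag 081I] -/
theorem ker_ι_preimage_eq_comap {T T₀ : Scheme.{u}} (j : T₀ ⟶ T) [IsOpenImmersion j]
    (O : T.Opens) [QuasiCompact O.ι] (O' : T₀.Opens) (hO' : O' = j ⁻¹ᵁ O) :
    O'.ι.ker = O.ι.ker.comap j := by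
  subst hO'
  refine Scheme.IdealSheafData.ext (funext fun W => ?_)
  rw [Scheme.ker_ideal_of_isPullback_of_isOpenImmersion O.ι (j ⁻¹ᵁ O).ι (j ∣_ O) j
    (isPullback_morphismRestrict j O).flip W, Scheme.IdealSheafData.ideal_comap_of_isOpenImmersion]

/-- **A Zariski-local-on-the-source property of a closed subscheme `V(K) → S'` can be checked
after restriction to open immersions covering `Supp K`**: if `P` holds for
`V(K|_{T₀}) ⊆ T₀ → T → S'` for open immersions `j : T₀ → T` jointly covering `Supp K`, then `P`
holds for `V(K) → S'` (the `V(K|_{T₀}) = V(K) ×_T T₀` form an open cover of `V(K)`).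
[folklore] -/
theorem of_forall_comap_subschemeι (P : MorphismProperty Scheme.{u}) [IsZariskiLocalAtSource P]
    {T S' : Scheme.{u}} (K : T.IdealSheafData) (h : T ⟶ S') {ι : Type u} {T₀ : ι → Scheme.{u}}
    (j : ∀ k, T₀ k ⟶ T) [∀ k, IsOpenImmersion (j k)]
    (hcov : (K.support : Set T) ⊆ ⋃ k, Set.range (j k))
    (H : ∀ k, P ((K.comap (j k)).subschemeι ≫ j k ≫ h)) : P (K.subschemeι ≫ h) := by
  let 𝒰 : K.subscheme.OpenCover := Scheme.Cover.mkOfCovers ι (fun k => pullback (j k) K.subschemeι)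
    (fun k => pullback.snd (j k) K.subschemeι) (fun z => by
      have hz : K.subschemeι z ∈ (K.support : Set T) := by
        rw [← Scheme.IdealSheafData.range_subschemeι]
        exact ⟨z, rfl⟩
      obtain ⟨k, hk⟩ := Set.mem_iUnion.mp (hcov hz)
      have : z ∈ Set.range (pullback.snd (j k) K.subschemeι) := by
        rw [Scheme.Pullback.range_snd]
        exact hk
      obtain ⟨y, hy⟩ := this
      exact ⟨k, y, hy⟩) (fun k => inferInstance)
  refine IsZariskiLocalAtSource.of_openCover 𝒰 fun k => ?_
  have e : pullback.fst (j k) K.subschemeι = (K.comapIso (j k)).inv ≫ (K.comap (j k)).subschemeι := by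
    rw [← Scheme.IdealSheafData.comapIso_hom_fst, Iso.inv_hom_id_assoc]
  show P (pullback.snd (j k) K.subschemeι ≫ K.subschemeι ≫ h)
  rw [← Category.assoc, ← pullback.condition, Category.assoc, e, Category.assoc,
    P.cancel_left_of_respectsIso]
  exact H k

end General

/-! ## The open pieces `X₀ ×_S S' ⊆ X ×_S S'` -/

section OpenPiece

variable {X S S' : Scheme.{u}} (f : X ⟶ S) (b : S' ⟶ S) (I : S.IdealSheafData) (X₀ : X.Opens)

/-- The open immersion `X₀ ×_S S' ↪ X ×_S S'` (for `X₀ ⊆ X` open): the base change of `X₀ ↪ X`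
along the first projection, through `X₀ ×_X (X ×_S S') ≅ X₀ ×_S S'`. [folklore] -/
def strictTransformOpenι : pullback (X₀.ι ≫ f) b ⟶ pullback f b :=
  (pullbackRightPullbackFstIso f b X₀.ι).inv ≫ pullback.snd X₀.ι (pullback.fst f b)

/-- `X₀ ×_S S' ↪ X ×_S S'` is an open immersion. [folklore] -/
instance isOpenImmersion_strictTransformOpenι : IsOpenImmersion (strictTransformOpenι f b X₀) := by
  unfold strictTransformOpenι
  infer_instance

/-- `X₀ ×_S S' ↪ X ×_S S' → S'` is the second projection. [folklore] -/
@[reassoc]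
theorem strictTransformOpenι_snd :
    strictTransformOpenι f b X₀ ≫ pullback.snd f b = pullback.snd (X₀.ι ≫ f) b := by
  rw [strictTransformOpenι, Category.assoc, pullbackRightPullbackFstIso_inv_snd_snd]

/-- `X₀ ×_S S' ↪ X ×_S S' → X` is the first projection followed by `X₀ ↪ X`. [folklore] -/
@[reassoc]
theorem strictTransformOpenι_fst :
    strictTransformOpenι f b X₀ ≫ pullback.fst f b = pullback.fst (X₀.ι ≫ f) b ≫ X₀.ι := by
  rw [strictTransformOpenι, Category.assoc, pullbackRightPullbackFstIso_inv_snd_fst]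

/-- The image of `X₀ ×_S S' ↪ X ×_S S'` is the preimage of `X₀` under the first projection.
[folklore] -/
theorem range_strictTransformOpenι :
    Set.range (strictTransformOpenι f b X₀) = (pullback.fst f b) ⁻¹' (X₀ : Set X) := by
  rw [strictTransformOpenι, Scheme.Hom.comp_base, TopCat.coe_comp, Set.range_comp,
    Set.range_eq_univ.mpr (ConcreteCategory.bijective_of_isIso _).2, Set.image_univ,
    Scheme.Pullback.range_snd, Scheme.Opens.range_ι]

/-- **Locality of the strict transform**: the ideal sheaf of the strict transform (Stacks 080D)
of `X₀ → S` along `b` (with respect to `V(𝓘)`) inside `X₀ ×_S S'` is the restriction of the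
ideal sheaf of the strict transform of `X → S`, provided `b⁻¹𝓘 𝒪_{S'}` is an effective Cartier
divisor (e.g. `b` a blowing up of `S` in `𝓘`; this makes the dense open quasi-compact, so that
its scheme-theoretic closure commutes with restriction to opens). [cite: StacksProject, Tag 081R (proof)] -/
theorem ker_blowupStrictTransformι_restrict (hE : IsEffectiveCartier (I.comap b)) :
    ((pullback.snd (X₀.ι ≫ f) b) ⁻¹ᵁ (b ⁻¹ᵁ centreCompl I)).ι.ker =
      ((pullback.snd f b) ⁻¹ᵁ (b ⁻¹ᵁ centreCompl I)).ι.ker.comap (strictTransformOpenι f b X₀) := by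
  haveI : QuasiCompact ((pullback.snd f b) ⁻¹ᵁ (b ⁻¹ᵁ centreCompl I)).ι := by
    rw [preimage_centreCompl]
    exact quasiCompact_ι_preimage_centreCompl _ hE
  refine ker_ι_preimage_eq_comap (strictTransformOpenι f b X₀) _ _ ?_
  rw [← strictTransformOpenι_snd]
  rfl

/-- **A property of morphisms which is Zariski-local on the source holds for the strict transform
of `X → S` along `b` as soon as it holds for the strict transforms of the members `Xₖ` of an open
cover of `X`** (`b⁻¹𝓘 𝒪_{S'}` an effective Cartier divisor, e.g. `b` a blowing up of `S` in
`𝓘`); e.g. `P = Flat`, `P = LocallyOfFinitePresentation` (the reduction to affine `X` in the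
printed proof of Stacks 081R). [cite: StacksProject, Tag 081R (proof)] -/
theorem blowupStrictTransformMap_of_iSup_eq_top (P : MorphismProperty Scheme.{u})
    [IsZariskiLocalAtSource P] (hE : IsEffectiveCartier (I.comap b)) {ι : Type u}
    (U : ι → X.Opens) (hU : ⨆ k, U k = ⊤)
    (H : ∀ k, P (blowupStrictTransformMap ((U k).ι ≫ f) b I)) :
    P (blowupStrictTransformMap f b I) := by
  refine of_forall_comap_subschemeι P (((pullback.snd f b) ⁻¹ᵁ (b ⁻¹ᵁ centreCompl I)).ι.ker)
    (pullback.snd f b) (fun k => strictTransformOpenι f b (U k)) (fun x _ => ?_) fun k => ?_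
  · have hx : pullback.fst f b x ∈ (⊤ : X.Opens) := trivial
    rw [← hU] at hx
    obtain ⟨k, hk⟩ := Opens.mem_iSup.mp hx
    refine Set.mem_iUnion.mpr ⟨k, ?_⟩
    rw [range_strictTransformOpenι]
    exact hk
  · rw [← ker_blowupStrictTransformι_restrict f b I (U k) hE, strictTransformOpenι_snd]
    exact H k

end OpenPiece

end Literature.AlgebraicGeometry.Resolution

end
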